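import Literature.NumberTheory.Transcendental.FormIntegrationBridgeProofs
import HarnessLib

/-!
# Nonnegativity of `∫_M f • vol_o` for `f ≥ 0` (discharge)

Topic: integration of differential forms; this file discharges the named fact
`Literature.NumberTheory.Transcendental.integral_smul_riemannianVolumeForm_nonneg` of
`Literature/NumberTheory/Transcendental/FormIntegration.lean`: for a pointwise nonnegative
function `f` on a Riemannian manifold with a bare orientation family `o`,
`0 ≤ ∫_M f • vol_o`, *unconditionally* (no smoothness, measurability, compactness or
continuity-of-orientation hypothesis: the Bochner integral and `finsum` return `0` at junk
values, and `0 ≤ 0`).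

## Proof architecture (Lee (2013), Prop. 16.6 (c))

Lee's proof of positivity, `∫_M ω > 0` for a positively oriented orientation form `ω`
(*Introduction to Smooth Manifolds*, 2nd ed., Prop. 16.6 (c)): in a positively oriented chart
the coordinate expression of `ω` is a positive function times `dx¹ ∧ ⋯ ∧ dxⁿ`, in a negatively
oriented one a negative function, so "each term in the sum (16.2) defining `∫_M ω` is
nonnegative". Here the sum (16.2) is `MForm.integralPU`, whose `i`-th chart integrand is
`chartSign o i y · ρ i x · (f x · g y)` with `x = (extChartAt I i).symm y` and
`g y = (vol_o).inChart i y (e₁, …, eₙ)` the volume form on the chart frame. The only input is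
that the Riemannian volume form is *positively oriented* (Lee (2013), Prop. 15.29), in the form
`chartSign o i y = Real.sign (g y)` proved in `FormIntegrationBridgeProofs`
(`chartSign_eq_sign_inChart_riemannianVolumeForm`); hence
`chartSign o i y · g y = sign (g y) · g y = |g y| ≥ 0`
(`chartSign_mul_inChart_riemannianVolumeForm_nonneg`). With `ρ i x ≥ 0` and `f x ≥ 0` every
chart integrand is pointwise `≥ 0`, and `MeasureTheory.integral_nonneg`, `finsum_nonneg`
finish — both valid without integrability or finiteness hypotheses.

## Main statements (all proved)

* `Literature.NumberTheory.Transcendental.chartSign_mul_inChart_riemannianVolumeForm_nonneg`: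
  the chart integrand of `vol_o` against `chartSign o` is pointwise `≥ 0`.
* `Literature.NumberTheory.Transcendental.integral_smul_riemannianVolumeForm_nonneg_holds :
  integral_smul_riemannianVolumeForm_nonneg o`.

## References

* J. M. Lee, *Introduction to Smooth Manifolds*, 2nd ed., GTM 218, Springer (2013),
  Prop. 15.29 (Riemannian volume form), Prop. 16.6 (c) (positivity of the integral).
-/

noncomputable section

open scoped Manifold ContDiff Topology
open Bundle Set Module _root_.MeasureTheory

namespace Literature.NumberTheory.Transcendental

section Discharge

variable {E : Type*} [NormedAddCommGroup E] [NormedSpace ℝ E] [FiniteDimensional ℝ E]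
  {n : ℕ} [Fact (finrank ℝ E = n)]
  {H : Type*} [TopologicalSpace H] {I : ModelWithCorners ℝ E H}
  {M : Type*} [TopologicalSpace M] [ChartedSpace H M]
  (o : (x : M) → Orientation ℝ (TangentSpace I x) (Fin n))
  [RiemannianBundle (fun x : M ↦ TangentSpace I x)]

/-- In every chart and at every chart point `y`, the chart integrand of the Riemannian volume
form against the orientation sign is nonnegative:
`0 ≤ chartSign o x₀ y * (vol_o).inChart x₀ y (e₁, …, eₙ)`, `e = modelBasis E n` — the chart
sign *is* the sign of that value (`chartSign_eq_sign_inChart_riemannianVolumeForm`: the volume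
form is positively oriented, Lee (2013), Prop. 15.29), and `sign t * t = |t| ≥ 0`. This is the
chartwise content of Lee (2013), proof of Prop. 16.6 (c). [cite: LeeSmoothManifolds2013, Prop. 16.6] -/
theorem chartSign_mul_inChart_riemannianVolumeForm_nonneg (x₀ : M) (y : E) :
    0 ≤ chartSign o x₀ y *
      (Literature.Geometry.Kaehler.riemannianVolumeForm o).inChart x₀ y (modelBasis E n) := by
  rw [chartSign_eq_sign_inChart_riemannianVolumeForm]
  exact Real.sign_mul_nonneg _

variable [MeasurableSpace E] [BorelSpace E] [T2Space M] [SigmaCompactSpace M] [IsManifold I ∞ M]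

/-- **Discharge of `integral_smul_riemannianVolumeForm_nonneg`** (Lee (2013), Prop. 16.6 (c),
nonnegativity half, in the unconditional form of the fact): for `f ≥ 0` pointwise,
`0 ≤ ∫_M f • vol_o`. Each chart integrand of `MForm.integralPU` is
`chartSign · ρ i · (f · vol_o(frame)) = (chartSign · vol_o(frame)) · (ρ i · f) ≥ 0`
(`chartSign_mul_inChart_riemannianVolumeForm_nonneg`, `SmoothPartitionOfUnity.nonneg`, `f ≥ 0`),
so each chart integral is `≥ 0` (`MeasureTheory.integral_nonneg`, valid at junk values) and so
is their `finsum` (`finsum_nonneg`). [cite: LeeSmoothManifolds2013, Prop. 16.6] -/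
theorem integral_smul_riemannianVolumeForm_nonneg_holds :
    integral_smul_riemannianVolumeForm_nonneg o := by
  intro f hf
  unfold Literature.Geometry.Kaehler.MForm.integral Literature.Geometry.Kaehler.MForm.integralPU
  refine finsum_nonneg fun i ↦ integral_nonneg fun y ↦ ?_
  change (0 : ℝ) ≤ _
  have hρ := (chartPartitionOfUnity I M).nonneg i ((extChartAt I (id i)).symm y)
  have hfx := hf ((extChartAt I (id i)).symm y)
  have hv := chartSign_mul_inChart_riemannianVolumeForm_nonneg o (id i) y
  have h1 : Literature.Geometry.Kaehler.MForm.inChart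
        (fun x ↦ f x • Literature.Geometry.Kaehler.riemannianVolumeForm o x) (id i) y
        (modelBasis E n) =
      f ((extChartAt I (id i)).symm y) *
        (Literature.Geometry.Kaehler.riemannianVolumeForm o).inChart (id i) y (modelBasis E n) :=
    rfl
  rw [h1, show ∀ a b c d : ℝ, a * b * (c * d) = a * d * (b * c) from fun a b c d ↦ by ring]
  exact mul_nonneg hv (mul_nonneg hρ hfx)

end Discharge

end Literature.NumberTheory.Transcendental

end
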